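import Mathlib
import HarnessLib
import Literature.MathematicalPhysics.QuantumFieldTheory.ConstructiveQFTWave0

/-!
# A box-apart family of links on `(ℤ/L)^ν`: for `L = s·q`, `s ≥ R + 2`, the `q^ν` links `(s·a, e_{i₀})`, `a ∈ (ℤ/q)^ν ≅ Fin q^ν`, have endpoints pairwise outside each other's sup-boxes of radius `R`

HONEST FRAMING: exact (Metropolis-corrected) sampling algorithms for lattice gauge theory;
figures of merit are autocorrelation/cost numbers at stated couplings and volumes; no
continuum-physics claim.

Venture `LatticeQCDFlow` (cell pub-lqcd), topic `Exactness`; FANOUT row 7 (`s0-cpn-null`: the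
S0-D1 rung — 2D CP⁹ on periodic `L × L` lattices).  NEW WORK of the cell over Mathlib
(`ZMod.intCast_eq_intCast_iff_dvd_sub`, `Int.eq_zero_of_abs_lt_dvd`) and the Literature torus
`Site ν L = Fin ν → ZMod L`, `Site.shift` (`Literature/MathematicalPhysics/QuantumFieldTheory/ConstructiveQFTWave0`);
nothing is cited as a fact.  Printed counterpart, NAMED ONLY: Engel–Schaefer, Comput. Phys. Commun.
182 (2011) 2107, §2 (periodic square lattices `L × L`).  The point: the entropy floor of this lineage on
the torus (`Exactness/TorusPairsEntropyFloor`, `Exactness/TorusLinkEntropyFloor`) is linear in the size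
of ANY family of links that are mutually `Box(2m+2)`-apart; here is the obvious such family with an
exact count — one link per cell of the sublattice `s·ℤ^ν`, `s ∣ L`, `s ≥ 2m+4` — so that the floor reads
`(L/s)^ν·(const)·c⁴ − L^ν·(tail)`: a THEOREM linear in the volume `L^ν`.

## Content

* `torus_sublattice_core` — the arithmetic: if `s·a'_i + ε'[i = i₀] ≡ s·a_i + ε[i = i₀] + v_i (mod s·q)`
  with `a_i ≠ a'_i` in `Fin q`, `ε, ε' ∈ {0,1}`, `|v_i| ≤ R`, `R + 2 ≤ s`, then `False`.
* **`torus_sublattice_links_box_apart`** — for `a ≠ a'` every endpoint of the link `(s·a', e_{i₀})` lies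
  outside the radius-`R` sup-box of every endpoint of the link `(s·a, e_{i₀})` — exactly the hypothesis
  `hapart` of the torus entropy floors, with index set `Fin ν → Fin q` of cardinality `q^ν`.

NOT CLAIMED: optimality of the spacing; anything about measures, flows or numbers.
-/

namespace Summit.Ventures.LatticeQCDFlow.Exactness

open Function Set Literature.MathematicalPhysics.QuantumFieldTheory

variable {ν L : ℕ}

/-- **The arithmetic core.**  `L = s·q`, `R + 2 ≤ s`; `a_i ≠ a'_i` in `Fin q`; `ε, ε' ∈ {0, 1}`;
`|v| ≤ R`; then `s·a'_i + ε'·δ ≡ s·a_i + ε·δ + v (mod L)` (`δ ∈ {0,1}`) is impossible. -/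
theorem torus_sublattice_core {s q R : ℕ} (hL : (L : ℤ) = s * q) (hs : R + 2 ≤ s) {ai ai' : Fin q}
    (hne : ai ≠ ai') {ε ε' δ v : ℤ} (hε : ε = 0 ∨ ε = 1) (hε' : ε' = 0 ∨ ε' = 1) (hδ : δ = 0 ∨ δ = 1)
    (hv : |v| ≤ R)
    (heq : (((s : ℤ) * (ai' : ℕ) + ε' * δ : ℤ) : ZMod L) = (((s : ℤ) * (ai : ℕ) + ε * δ + v : ℤ) : ZMod L)) :
    False := by
  rw [ZMod.intCast_eq_intCast_iff_dvd_sub, hL] at heq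
  -- `s ∣ (ε − ε')δ + v`, which is smaller than `s` in absolute value, hence zero
  have hsdvd : (s : ℤ) ∣ (ε - ε') * δ + v := by
    have h1 : (s : ℤ) ∣ (s : ℤ) * (ai : ℕ) + ε * δ + v - ((s : ℤ) * (ai' : ℕ) + ε' * δ) :=
      dvd_trans (dvd_mul_right _ _) heq
    have h2 : (s : ℤ) ∣ (s : ℤ) * ((ai : ℕ) - (ai' : ℕ) : ℤ) := dvd_mul_right _ _
    have e : (ε - ε') * δ + v =
        ((s : ℤ) * (ai : ℕ) + ε * δ + v - ((s : ℤ) * (ai' : ℕ) + ε' * δ)) - (s : ℤ) * ((ai : ℕ) - (ai' : ℕ) : ℤ) := by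
      ring
    rw [e]
    exact dvd_sub h1 h2
  have hsmall : |(ε - ε') * δ + v| < s := by
    have h1 : |(ε - ε') * δ| ≤ 1 := by
      rcases hε with rfl | rfl <;> rcases hε' with rfl | rfl <;> rcases hδ with rfl | rfl <;> simp
    have h2 : |(ε - ε') * δ + v| ≤ 1 + R := (abs_add_le _ _).trans (add_le_add h1 hv)
    have h3 : (1 : ℤ) + R < s := by exact_mod_cast (show 1 + R < s by omega)
    exact lt_of_le_of_lt h2 h3
  have hzero : (ε - ε') * δ + v = 0 := Int.eq_zero_of_abs_lt_dvd hsdvd hsmall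
  -- hence `s·q ∣ s·(a_i − a'_i)`, so `q ∣ a_i − a'_i`, impossible for distinct elements of `Fin q`
  have hdvd2 : (s : ℤ) * q ∣ (s : ℤ) * ((ai : ℕ) - (ai' : ℕ) : ℤ) := by
    have e : (s : ℤ) * ((ai : ℕ) - (ai' : ℕ) : ℤ) =
        (s : ℤ) * (ai : ℕ) + ε * δ + v - ((s : ℤ) * (ai' : ℕ) + ε' * δ) - ((ε - ε') * δ + v) := by ring
    rw [e, hzero, sub_zero]
    exact heq
  have hs0 : (s : ℤ) ≠ 0 := by exact_mod_cast (show s ≠ 0 by omega)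
  have hq : (q : ℤ) ∣ ((ai : ℕ) - (ai' : ℕ) : ℤ) := (mul_dvd_mul_iff_left hs0).1 hdvd2
  have hlt : |((ai : ℕ) - (ai' : ℕ) : ℤ)| < q := by
    rw [abs_sub_lt_iff]
    constructor <;> omega
  have h0 := Int.eq_zero_of_abs_lt_dvd hq hlt
  exact hne (Fin.ext (by omega))

/-- **THE SUBLATTICE LINK FAMILY IS BOX-APART.**  `L = s·q` (as naturals), `R + 2 ≤ s`, a direction
`i₀`; the links `(x_a, i₀)` with `x_a = (s·a_i mod L)_i`, `a ∈ Fin ν → Fin q`: for `a ≠ a'`, no endpoint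
of the link at `a'` lies in the radius-`R` sup-box of an endpoint of the link at `a`. -/
theorem torus_sublattice_links_box_apart {s q R : ℕ} (hL : L = s * q) (hs : R + 2 ≤ s) (i₀ : Fin ν)
    {a a' : Fin ν → Fin q} (haa : a ≠ a') :
    ∀ b ∈ ({(fun i => (((s * (a i : ℕ) : ℕ) : ℤ) : ZMod L)),
        Site.shift (fun i => (((s * (a i : ℕ) : ℕ) : ℤ) : ZMod L)) i₀} : Finset (Site ν L)),
    ∀ b' ∈ ({(fun i => (((s * (a' i : ℕ) : ℕ) : ℤ) : ZMod L)),
        Site.shift (fun i => (((s * (a' i : ℕ) : ℕ) : ℤ) : ZMod L)) i₀} : Finset (Site ν L)),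
      b' ∉ (Fintype.piFinset fun _ : Fin ν => Finset.Icc (-(R : ℤ)) (R : ℤ)).image
        (fun v : Fin ν → ℤ => b + fun i => ((v i : ℤ) : ZMod L)) := by
  have hL' : (L : ℤ) = s * q := by exact_mod_cast hL
  obtain ⟨i, hi⟩ := Function.ne_iff.1 haa
  -- every endpoint is `x + ε·e_{i₀}` with `ε ∈ {0,1}`; write its `i`-th coordinate accordingly
  have hends : ∀ (aa : Fin ν → Fin q),
      ∀ b ∈ ({(fun i => (((s * (aa i : ℕ) : ℕ) : ℤ) : ZMod L)),
        Site.shift (fun i => (((s * (aa i : ℕ) : ℕ) : ℤ) : ZMod L)) i₀} : Finset (Site ν L)),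
      ∃ ε : ℤ, (ε = 0 ∨ ε = 1) ∧
        b i = (((s : ℤ) * (aa i : ℕ) + ε * (if i = i₀ then 1 else 0) : ℤ) : ZMod L) := by
    intro aa b hb
    rcases Finset.mem_insert.1 hb with rfl | hb
    · exact ⟨0, Or.inl rfl, by push_cast; ring_nf⟩
    · rw [Finset.mem_singleton] at hb
      subst hb
      refine ⟨1, Or.inr rfl, ?_⟩
      simp only [Site.shift, Pi.add_apply, Pi.single_apply]
      split_ifs <;> push_cast <;> ring_nf
  intro b hb b' hb' hbox
  obtain ⟨ε, hε, hbi⟩ := hends a b hb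
  obtain ⟨ε', hε', hb'i⟩ := hends a' b' hb'
  simp only [Finset.mem_image, Fintype.mem_piFinset, Finset.mem_Icc] at hbox
  obtain ⟨v, hv, hvb⟩ := hbox
  have hvi : |v i| ≤ R := abs_le.2 (hv i)
  have hcoord := congr_fun hvb i
  simp only [Pi.add_apply] at hcoord
  rw [hbi, hb'i] at hcoord
  -- hcoord : ↑(s a_i + ε δ) + ↑(v i) = ↑(s a'_i + ε' δ)
  have heq : (((s : ℤ) * (a' i : ℕ) + ε' * (if i = i₀ then 1 else 0) : ℤ) : ZMod L) =
      (((s : ℤ) * (a i : ℕ) + ε * (if i = i₀ then 1 else 0) + v i : ℤ) : ZMod L) := by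
    rw [← hcoord]; push_cast; ring
  exact torus_sublattice_core hL' hs hi hε hε' (by by_cases h : i = i₀ <;> simp [h]) hvi heq

end Summit.Ventures.LatticeQCDFlow.Exactness
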